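import Summits.CriticalPhenomena.PercolationContinuityZ3.Theorems.Transplant.FKConnectivityAllQEdgeToggle
import HarnessLib

/-!
# Connectivity correlation inequalities for `φ_{w,q}`, every `q > 0` — loop erasure: diagonal pairs are independent coins

Support file (`--supports stmt-CriticalPhenomena-4575`), FK sub-lane `prim-bschramm-fk-3` (gen 6) of the post-continuity
programme; builds on p205010 (kernel theorem, internal audit signed; external expert review pending).  No definitions, no named
facts, no sorries; standard axioms.

The tree's random-cluster measure `rcMeasureW w q ∅` (Grimmett's (1.20)) lives on configurations `ω ⊆ Sym2 V` INCLUDING the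
diagonal pairs `s(x,x)` (loops).  A loop never changes the cluster count, so it is an independent `Bernoulli(w_{xx})` coin: for an
event `F` insensitive to the loop, `φ_w(F) = φ_{w[xx ↦ 0]}(F)`, and `φ_w(J_e ∩ J_{xx}) = φ_w(J_e)·φ_w(J_{xx})`.  This bookkeeping
is what lets a statement about weight vectors whose SUPPORT GRAPH (`SimpleGraph.fromEdgeSet`, which ignores loops) is
series–parallel — the named fact `Wagner2008_rc_edgeNegCorr_of_noK4Minor` — be reduced to weight vectors supported on the
nondiagonal pairs of a 2-tree (fk-1's `FK.rc_edgeNegCorr_of_isTwoTree`).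
* `FK.sum_rcWeightW_update_loop` / `FK.rcPartitionFunctionW_update_loop` — `S_{w[xx↦1]}(F) = S_{w[xx↦0]}(F)` for `F`
  insensitive to `s(x,x)`, and `Z_{w[xx↦1]} = Z_{w[xx↦0]}` (toggle identity of `…EdgeToggle` at `x = y`);
* `FK.rcMeasureW_real_update_loop_zero` — `φ_w(F) = φ_{w[xx↦0]}(F)` for such `F`;
* `FK.rcMeasureW_real_eraseLoops` — `φ_w(F) = φ_{w°}(F)` where `w°` zeroes every diagonal pair, for `F` insensitive to loops;
* `FK.rcMeasureW_real_inter_loop` — `φ_w(J_e ∩ J_{xx}) = φ_w(J_e)·φ_w(J_{xx})` (`e ≠ s(x,x)`).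
[cite: Grimmett2006, §1.4 eq. (1.20) (p. 15); Thm. (3.1)(a) (p. 37)]
-/

noncomputable section

namespace Summit.CriticalPhenomena.PercolationContinuityZ3.Theorems

namespace FK

open MeasureTheory Set Literature.Probability.LatticeModels Literature.Probability.Percolation
open Literature.Probability.Percolation.DecisionTree (ind ind_of_mem ind_of_not_mem ind_nonneg)
open scoped Classical symmDiff

variable {V : Type*} [Fintype V]

/-! ### One loop -/

omit [Fintype V] in
/-- The complement of `{x ↔ x}` is empty. [folklore] -/
theorem compl_openConn_self (x : V) : (openConn x x : Set (BondConfig V))ᶜ = ∅ :=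
  Set.compl_empty_iff.2 (Set.eq_univ_of_forall fun ω => (mem_openConn_iff' x x ω).2 (SimpleGraph.Reachable.refl x))

/-- **A loop is a free coin (masses)**: for `F` insensitive to the loop `s(x,x)`, `S_{w[xx↦1]}(F) = S_{w[xx↦0]}(F)`.
[cite: Grimmett2006, Thm. (3.1)(a) (p. 37); §1.4 eq. (1.20) (p. 15)] -/
theorem sum_rcWeightW_update_loop (w : Sym2 V → unitInterval) {q : ℝ} (hq : q ≠ 0) (x : V) (F : Set (BondConfig V))
    (hF : ∀ ω : BondConfig V, ω ∆ {s(x, x)} ∈ F ↔ ω ∈ F) :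
    ∑ ω : BondConfig V, rcWeightW (Function.update w s(x, x) 1) q ∅ ω * ind F ω =
      ∑ ω : BondConfig V, rcWeightW (Function.update w s(x, x) 0) q ∅ ω * ind F ω := by
  rw [sum_rcWeightW_update_one_eq_toggle w hq x x F hF, compl_openConn_self, Set.inter_empty]
  have h0 : ∑ ω : BondConfig V, rcWeightW (Function.update w s(x, x) 0) q ∅ ω * ind (∅ : Set (BondConfig V)) ω = 0 :=
    Finset.sum_eq_zero fun ω _ => by rw [ind_of_not_mem (Set.notMem_empty ω), mul_zero]
  rw [h0, mul_zero, add_zero]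

/-- **A loop is a free coin (partition function)**: `Z_{w[xx↦1]} = Z_{w[xx↦0]}`. [cite: Grimmett2006, Thm. (3.1)(a) (p. 37)] -/
theorem rcPartitionFunctionW_update_loop (w : Sym2 V → unitInterval) {q : ℝ} (hq : q ≠ 0) (x : V) :
    rcPartitionFunctionW (Function.update w s(x, x) 1) q ∅ = rcPartitionFunctionW (Function.update w s(x, x) 0) q ∅ := by
  rw [rcPartitionFunctionW_update_one_eq_toggle w hq x x, compl_openConn_self]
  have h0 : ∑ ω : BondConfig V, rcWeightW (Function.update w s(x, x) 0) q ∅ ω * ind (∅ : Set (BondConfig V)) ω = 0 :=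
    Finset.sum_eq_zero fun ω _ => by rw [ind_of_not_mem (Set.notMem_empty ω), mul_zero]
  rw [h0, mul_zero, add_zero]

/-- Masses of loop-insensitive events do not depend on the loop parameter: `S_w(F) = S_{w[xx↦0]}(F)`.
[cite: Grimmett2006, §1.4 eq. (1.20) (p. 15)] -/
theorem sum_rcWeightW_loop_eq_zero (w : Sym2 V → unitInterval) {q : ℝ} (hq : q ≠ 0) (x : V) (F : Set (BondConfig V))
    (hF : ∀ ω : BondConfig V, ω ∆ {s(x, x)} ∈ F ↔ ω ∈ F) :
    ∑ ω : BondConfig V, rcWeightW w q ∅ ω * ind F ω =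
      ∑ ω : BondConfig V, rcWeightW (Function.update w s(x, x) 0) q ∅ ω * ind F ω := by
  rw [sum_rcWeightW_ind_affine w q s(x, x) F, sum_rcWeightW_update_loop w hq x F hF]
  ring

/-- The partition function does not depend on loop parameters: `Z_w = Z_{w[xx↦0]}`. [cite: Grimmett2006, §1.4 eq. (1.20) (p. 15)] -/
theorem rcPartitionFunctionW_loop_eq_zero (w : Sym2 V → unitInterval) {q : ℝ} (hq : q ≠ 0) (x : V) :
    rcPartitionFunctionW w q ∅ = rcPartitionFunctionW (Function.update w s(x, x) 0) q ∅ := by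
  rw [rcPartitionFunctionW_affine w q s(x, x), rcPartitionFunctionW_update_loop w hq x]
  ring

/-- **Loop erasure, one loop**: `φ_w(F) = φ_{w[xx↦0]}(F)` for every event `F` insensitive to the loop `s(x,x)`.
[cite: Grimmett2006, §1.4 eq. (1.20) (p. 15); Thm. (3.1)(a) (p. 37)] -/
theorem rcMeasureW_real_update_loop_zero (w : Sym2 V → unitInterval) {q : ℝ} (hq : 0 < q) (x : V)
    (F : Set (BondConfig V)) (hF : ∀ ω : BondConfig V, ω ∆ {s(x, x)} ∈ F ↔ ω ∈ F) :
    (rcMeasureW w q ∅).real F = (rcMeasureW (Function.update w s(x, x) 0) q ∅).real F := by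
  rw [rcMeasureW_real_eq_sum_div w hq ∅ F, rcMeasureW_real_eq_sum_div _ hq ∅ F,
    sum_rcWeightW_loop_eq_zero w hq.ne' x F hF, rcPartitionFunctionW_loop_eq_zero w hq.ne' x]

/-- **A loop is independent of everything else**: `φ_w(J_{xx} ∩ J_e)·1 = φ_w(J_{xx})·φ_w(J_e)` — precisely,
`φ_w({xx ∈ ω} ∩ {e ∈ ω}) = φ_w({e ∈ ω})·φ_w({xx ∈ ω})` for every pair `e ≠ s(x,x)`.
[cite: Grimmett2006, §1.4 eq. (1.20) (p. 15); Thm. (3.1)(a) (p. 37)] -/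
theorem rcMeasureW_real_inter_loop (w : Sym2 V → unitInterval) {q : ℝ} (hq : 0 < q) (x : V) {e : Sym2 V}
    (he : e ≠ s(x, x)) :
    (rcMeasureW w q ∅).real ({ω | e ∈ ω} ∩ {ω | s(x, x) ∈ ω}) =
      (rcMeasureW w q ∅).real {ω | e ∈ ω} * (rcMeasureW w q ∅).real {ω | s(x, x) ∈ ω} := by
  have hZ := rcPartitionFunctionW_pos w hq (∅ : Set V)
  have hq' := hq.ne'
  -- `J_e` is insensitive to the loop
  have hJe : ∀ ω : BondConfig V, ω ∆ {s(x, x)} ∈ {ω : BondConfig V | e ∈ ω} ↔ ω ∈ {ω : BondConfig V | e ∈ ω} := by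
    intro ω
    simp only [Set.mem_setOf_eq, Set.mem_symmDiff, Set.mem_singleton_iff]
    constructor
    · rintro (⟨h, -⟩ | ⟨h, -⟩)
      · exact h
      · exact (he h).elim
    · intro h; exact Or.inl ⟨h, he⟩
  rw [Set.inter_comm, rcMeasureW_real_eq_sum_div w hq ∅, rcMeasureW_real_eq_sum_div w hq ∅,
    rcMeasureW_real_eq_sum_div w hq ∅, sum_rcWeightW_ind_inter_openPair w q s(x, x) {ω | e ∈ ω},
    sum_rcWeightW_ind_openPair w q s(x, x), sum_rcWeightW_update_loop w hq' x _ hJe,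
    ← sum_rcWeightW_loop_eq_zero w hq' x _ hJe, rcPartitionFunctionW_update_loop w hq' x,
    ← rcPartitionFunctionW_loop_eq_zero w hq' x]
  field_simp

/-! ### All loops at once -/

omit [Fintype V] in
/-- Zeroing the parameters of the pairs in a finite set `D`. [folklore] -/
theorem update_zeroOn_insert (w : Sym2 V → unitInterval) (D : Finset (Sym2 V)) (ℓ : Sym2 V) :
    (fun e => if e ∈ insert ℓ D then (0 : unitInterval) else w e) =
      Function.update (fun e => if e ∈ D then (0 : unitInterval) else w e) ℓ 0 := by
  funext e
  by_cases h : e = ℓ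
  · subst h; simp
  · rw [Function.update_of_ne h]
    simp [Finset.mem_insert, h]

/-- **Loop erasure on a set of loops**: zeroing the parameters of any finite set `D` of DIAGONAL pairs does not change the
probability of an event insensitive to every loop. [cite: Grimmett2006, §1.4 eq. (1.20) (p. 15)] -/
theorem rcMeasureW_real_zeroOn_diag (w : Sym2 V → unitInterval) {q : ℝ} (hq : 0 < q) (F : Set (BondConfig V))
    (hF : ∀ x : V, ∀ ω : BondConfig V, ω ∆ {s(x, x)} ∈ F ↔ ω ∈ F) :
    ∀ D : Finset (Sym2 V), (∀ ℓ ∈ D, ℓ.IsDiag) →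
      (rcMeasureW w q ∅).real F = (rcMeasureW (fun e => if e ∈ D then (0 : unitInterval) else w e) q ∅).real F := by
  intro D
  induction D using Finset.induction_on with
  | empty => intro _; simp
  | insert ℓ D hℓ ih =>
    intro hD
    rw [ih fun ℓ' hℓ' => hD ℓ' (Finset.mem_insert_of_mem hℓ'), update_zeroOn_insert]
    have hdiag := hD ℓ (Finset.mem_insert_self _ _)
    induction ℓ using Sym2.ind with
    | h x y =>
      have hxy : x = y := Sym2.mk_isDiag_iff.1 hdiag
      subst hxy
      exact rcMeasureW_real_update_loop_zero _ hq x F (hF x)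

/-- **Loop erasure**: with `w° e = 0` on diagonal pairs and `w° e = w e` otherwise, `φ_w(F) = φ_{w°}(F)` for every event `F`
insensitive to every loop. [cite: Grimmett2006, §1.4 eq. (1.20) (p. 15); Thm. (3.1)(a) (p. 37)] -/
theorem rcMeasureW_real_eraseLoops (w : Sym2 V → unitInterval) {q : ℝ} (hq : 0 < q) (F : Set (BondConfig V))
    (hF : ∀ x : V, ∀ ω : BondConfig V, ω ∆ {s(x, x)} ∈ F ↔ ω ∈ F) :
    (rcMeasureW w q ∅).real F = (rcMeasureW (fun e => if e.IsDiag then (0 : unitInterval) else w e) q ∅).real F := by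
  have h := rcMeasureW_real_zeroOn_diag w hq F hF (Finset.univ.filter fun e : Sym2 V => e.IsDiag)
    (fun ℓ hℓ => (Finset.mem_filter.1 hℓ).2)
  rw [h]
  congr 2
  funext e
  simp [Finset.mem_filter]

omit [Fintype V] in
/-- The event `{e ∈ ω}` is insensitive to every loop other than `e`. [folklore] -/
theorem openPair_loop_insensitive {e : Sym2 V} (he : ¬ e.IsDiag) (x : V) (ω : BondConfig V) :
    ω ∆ {s(x, x)} ∈ {ω : BondConfig V | e ∈ ω} ↔ ω ∈ {ω : BondConfig V | e ∈ ω} := by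
  have hne : e ≠ s(x, x) := fun h => he (h ▸ Sym2.mk_isDiag_iff.2 rfl)
  simp only [Set.mem_setOf_eq, Set.mem_symmDiff, Set.mem_singleton_iff]
  constructor
  · rintro (⟨h, -⟩ | ⟨h, -⟩)
    · exact h
    · exact (hne h).elim
  · intro h; exact Or.inl ⟨h, hne⟩

omit [Fintype V] in
/-- The event `{e ∈ ω} ∩ {f ∈ ω}` is insensitive to every loop when `e`, `f` are not loops. [folklore] -/
theorem openPair_inter_loop_insensitive {e f : Sym2 V} (he : ¬ e.IsDiag) (hf : ¬ f.IsDiag) (x : V) (ω : BondConfig V) :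
    ω ∆ {s(x, x)} ∈ ({ω : BondConfig V | e ∈ ω} ∩ {ω | f ∈ ω}) ↔ ω ∈ ({ω : BondConfig V | e ∈ ω} ∩ {ω | f ∈ ω}) := by
  rw [Set.mem_inter_iff, Set.mem_inter_iff, openPair_loop_insensitive he, openPair_loop_insensitive hf]

end FK

end Summit.CriticalPhenomena.PercolationContinuityZ3.Theorems

end
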